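import Summits.QuantumAdvantage.QuantumAdvantage.Theses.LinnikCubicClassGroups
import Literature.Computability.Cryptography.CubicClassSamplingSpecs
import Literature.Computability.Cryptography.CubicClassTableFPLadder
import Literature.Computability.Cryptography.CubicClassPostProgFP

/-!
# Crux `LinnikCubicClassGroups.PureCubicClassGroupFBQP` (stmt-QuantumAdvantage-11544) — stub `stub_classTableProg` (S5b-P5a)

Line `arakelov-giant-step-cycle`. The PROGRAMMING part of the class-group stage of Hallgren's class-number algorithm for
`ℚ(∛(ab²))`: the ladder class table `classTableOpQ` (`CubicClassTableLadder.lean`) and the capped post-processor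
`PostParams.postOutC` (`CubicClassSamplingSpecs.lean`) are typed polynomial time (`ClaimTableFP`). No number theory: the
table is the pointwise `CodeFP` composition `WalkFns.codeFP_classTableOpQ` of `CubicClassTableFP{Kernel,Gens,Pow,Exp,Ladder}.lean`
(closure of polynomial time under composition and folds with a step-indexed size invariant, `CodeFPInvFolds.lean`), read off
the argument tuple `tableArgsE` (binary `a b m r margin cap v`, raw `ps`, the lattice code `ord`, unary
`k prec s ℓe npp ℓy ℓκ ℓb s₀ Tdbl Bfin Bb`); the post-processor is `PostParams.codeFP_postOutCap` of `CubicClassPostProgFP.lean`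
(decoding, reduced pairing, `roundB` by the continued-fraction scan of `CubicClassPostRoundFP.lean`, the rows, `lcmDen`, the
residue rows, `HowellFP.subgroupOrderPureC`, capped at the denominator bound) read off `postArgsE`.
-/

set_option linter.dupNamespace false -- path-aligned namespace: the summit and the problem are both `QuantumAdvantage`

namespace Summit.QuantumAdvantage.QuantumAdvantage.Theorems.LinnikCubicClassGroups

open Literature.Computability.Complexity (CodeFP)
open Literature.Computability.Complexity.CodeFP (pairE strE natE intE bitE unE rawE fst snd)
open Literature.Computability.Cryptography (CubicClassTable.WalkFns CubicClassTable.Inst)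
open Literature.Computability.Cryptography.CubicClassSampling
open Literature.Computability.Cryptography.CubicClassPost (PostParams.codeFP_postOutCap)

/-- **The ladder class table on its argument tuple is computed on codes**: every field of the instance, the cap and the
position are projections of the tuple code `tableArgsE`, so `WalkFns.codeFP_classTableOpQ` applies with the context
`TableArgs`. [folklore] -/
theorem codeFP_classTableOpQ_args (Fw : CubicClassTable.WalkFns)
    (hroots : CodeFP (pairE natE (pairE natE strE)) (rawE natE) Fw.roots)
    (hprime : CodeFP (pairE (pairE natE natE) (pairE (pairE natE (rawE intE)) (pairE natE natE))) (pairE natE (rawE intE)) Fw.primeL)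
    (hlat : CodeFP (pairE (pairE natE natE) (pairE (pairE natE (rawE intE)) (pairE natE (rawE intE)))) (pairE natE (rawE intE)) Fw.latProd)
    (hred : CodeFP (pairE (pairE (pairE natE natE) unE) (pairE natE (rawE intE))) (pairE (pairE natE (rawE intE)) intE) Fw.redL)
    (hlat6 : ∀ x, (Fw.latProd x).2.length ≤ 6) (hred6 : ∀ x, ((Fw.redL x).1).2.length ≤ 6) :
    CodeFP tableArgsE (pairE (pairE natE (rawE intE)) natE) (fun q : TableArgs => Fw.classTableOpQ (instOfArgs q) q.2.1 q.2.2) := by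
  -- the tuple of the instance fields and its successive tails
  have h1 : CodeFP tableArgsE (pairE natE (pairE natE (pairE natE (pairE (rawE natE) (pairE (pairE natE (rawE intE)) (pairE natE (pairE unE
      (pairE unE (pairE unE (pairE unE (pairE unE (pairE unE (pairE unE (pairE unE (pairE unE (pairE unE (pairE unE
      (pairE unE natE)))))))))))))))))) (fun q : TableArgs => q.1) := fst _ _
  have t1 := h1.snd'
  have t2 := t1.snd'
  have t3 := t2.snd'
  have t4 := t3.snd'
  have t5 := t4.snd'
  have t6 := t5.snd'
  have t7 := t6.snd'
  have t8 := t7.snd'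
  have t9 := t8.snd'
  have t10 := t9.snd'
  have t11 := t10.snd'
  have t12 := t11.snd'
  have t13 := t12.snd'
  have t14 := t13.snd'
  have t15 := t14.snd'
  have t16 := t15.snd'
  have t17 := t16.snd'
  have ha : CodeFP tableArgsE natE (fun q : TableArgs => (instOfArgs q).a) := h1.fst'
  have hb : CodeFP tableArgsE natE (fun q : TableArgs => (instOfArgs q).b) := t1.fst'
  have hm : CodeFP tableArgsE natE (fun q : TableArgs => (instOfArgs q).m) := t2.fst'
  have hps : CodeFP tableArgsE (rawE natE) (fun q : TableArgs => (instOfArgs q).ps) := t3.fst'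
  have hord : CodeFP tableArgsE (pairE natE (rawE intE)) (fun q : TableArgs => (instOfArgs q).ord) := t4.fst'
  have hr : CodeFP tableArgsE natE (fun q : TableArgs => (instOfArgs q).r) := t5.fst'
  have hk : CodeFP tableArgsE unE (fun q : TableArgs => (instOfArgs q).k) := t6.fst'
  have hprec : CodeFP tableArgsE unE (fun q : TableArgs => (instOfArgs q).prec) := t7.fst'
  have hs : CodeFP tableArgsE unE (fun q : TableArgs => (instOfArgs q).s) := t8.fst'
  have hℓe : CodeFP tableArgsE unE (fun q : TableArgs => (instOfArgs q).ℓe) := t9.fst'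
  have hnpp : CodeFP tableArgsE unE (fun q : TableArgs => (instOfArgs q).npp) := t10.fst'
  have hℓy : CodeFP tableArgsE unE (fun q : TableArgs => (instOfArgs q).ℓy) := t11.fst'
  have hℓκ : CodeFP tableArgsE unE (fun q : TableArgs => (instOfArgs q).ℓκ) := t12.fst'
  have hℓb : CodeFP tableArgsE unE (fun q : TableArgs => (instOfArgs q).ℓb) := t13.fst'
  have hs₀ : CodeFP tableArgsE unE (fun q : TableArgs => (instOfArgs q).s₀) := t14.fst'
  have hTdbl : CodeFP tableArgsE unE (fun q : TableArgs => (instOfArgs q).Tdbl) := t15.fst'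
  have hBb : CodeFP tableArgsE unE (fun q : TableArgs => (instOfArgs q).Bb) := t17.fst'
  have hmargin : CodeFP tableArgsE natE (fun q : TableArgs => (instOfArgs q).margin) := t17.snd'
  have hcap : CodeFP tableArgsE natE (fun q : TableArgs => q.2.1) := (snd _ _).fst'
  have hv : CodeFP tableArgsE natE (fun q : TableArgs => q.2.2) := (snd _ _).snd'
  exact Fw.codeFP_classTableOpQ (σ := TableArgs) (eσ := tableArgsE) (I := instOfArgs) (cap := fun q => q.2.1) (v := fun q => q.2.2)
    hroots hprime hlat hred hlat6 hred6 ha hb hm hps hord hr hk hprec hs hℓe hnpp hℓy hℓκ hℓb hs₀ hTdbl hBb hmargin hcap hv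

/-- **The capped post-processor on its argument tuple is computed on codes** (`PostParams.codeFP_postOutCap` with the
context `PostArgs`; `postOutC` unfolds to the capped form). [folklore] -/
theorem codeFP_postOutC_args : CodeFP postArgsE natE (fun q : PostArgs => (postOfArgs q).postOutC q.2) := by
  have h1 : CodeFP postArgsE (pairE unE (pairE unE (pairE unE (pairE unE (pairE unE (pairE natE natE)))))) (fun q : PostArgs => q.1) := fst _ _
  have t1 := h1.snd'
  have t2 := t1.snd'
  have t3 := t2.snd'
  have t4 := t3.snd'
  have t5 := t4.snd'
  have hT : CodeFP postArgsE unE (fun q : PostArgs => (postOfArgs q).T) := h1.fst'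
  have hℓe : CodeFP postArgsE unE (fun q : PostArgs => (postOfArgs q).ℓe) := t1.fst'
  have hs : CodeFP postArgsE unE (fun q : PostArgs => (postOfArgs q).s) := t2.fst'
  have haexp : CodeFP postArgsE unE (fun q : PostArgs => (postOfArgs q).aexp) := t3.fst'
  have htop : CodeFP postArgsE unE (fun q : PostArgs => (postOfArgs q).top) := t4.fst'
  have hK₀ : CodeFP postArgsE natE (fun q : PostArgs => (postOfArgs q).K₀) := t5.fst'
  have hB : CodeFP postArgsE natE (fun q : PostArgs => (postOfArgs q).B) := t5.snd'
  have hcs : CodeFP postArgsE (rawE natE) (fun q : PostArgs => q.2) := snd _ _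
  exact (PostParams.codeFP_postOutCap (σ := PostArgs) (eσ := postArgsE) (P := postOfArgs) (cs := fun q => q.2)
    hT hℓe hs haexp htop hK₀ hB hcs).congr fun q => rfl

/-- (REGISTERED SIGNATURE — do not change.) **S5b-P5a `stub_classTableProg`**: the ladder class table and the capped
post-processor are typed polynomial time (`ClaimTableFP`, `Literature/Computability/Cryptography/CubicClassSamplingSpecs.lean`). -/
theorem stub_classTableProg : ClaimTableFP :=
  ⟨fun Fw hroots hprime hlat hred hlat6 hred6 => codeFP_classTableOpQ_args Fw hroots hprime hlat hred hlat6 hred6,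
    codeFP_postOutC_args⟩

end Summit.QuantumAdvantage.QuantumAdvantage.Theorems.LinnikCubicClassGroups
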